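import Mathlib
import Literature.Geometry.Lorentzian.AxisymmetricBlackHoleUniqueness
import HarnessLib

/-!
# KillingAlgebraAsymptoticallyFlat

Topic `Literature/Geometry/Lorentzian`. Named literature fact(s) relocated by the gate from `Summits/FinalStateConjecture/FinalStateConjecture/Theorems/ZeroEnergyKerrOrBombZeroEnergyRigidityStubRotatingUniqueness.lean`
(accept-time relocation of `[cite]`d propositions written inline in a Summits proposal; human ruling 2026-08-15).
Sources: BeigChrusciel1997, ChruscielCostaHeusler2012.

* `Literature.Geometry.Lorentzian.`
-/

namespace Literature.Geometry.Lorentzian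

open Set Function Literature.Geometry.Lorentzian
open scoped Manifold ContDiff Topology

/-- **Beig–Chruściel: in an `I⁺`-regular stationary vacuum black-hole space-time, a second
complete Killing field has an axisymmetric linear combination with the stationary one** (named
fact, D-0014; stated inline in the tree's vocabulary, WEAKER than print).

Printed sources.  (1) R. Beig, P. T. Chruściel, Commun. Math. Phys. 188 (1997) 585–597 =
arXiv:gr-qc/9610034, **Theorem 1.2**: "Under the conditions of Theorem 1.1 [a space-time
`(M, g)` containing an asymptotically flat boost-type domain `Ω` with time-like (non-vanishing)
ADM four momentum `p^μ`, fall-off `1/2 < α < 1`, `k ≥ 3`, `{t = 0} ⊂ Ω` Lorentz-transformable to an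
asymptotically `p`-orthogonal hypersurface in `Ω`, Einstein tensor `G_{μν} = O(r^{-3-ε})`], let
`G₀` denote the connected component of the group of all isometries of `(M, g)`. If `G₀` is
non-trivial, then one of the following holds: 1. `G₀ = ℝ` …; 2. `G₀ = U(1)`, and `(M, g)` is
axisymmetric; 3. `G₀ = ℝ × U(1)`, and `(M, g)` is stationary–axisymmetric; 4. `G₀ = SO(3)` …;
5. `G₀ = ℝ × SO(3)`, and `(M, g)` is stationary–spherically symmetric", where (ibid., §1)
"*Axisymmetric*, if `X^μ` has complete periodic orbits. Moreover `X^μ` will be required to have an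
axis, that is, the set `{p : X^μ(p) = 0} ≠ ∅`" and "*Stationary–axisymmetric*, if there exist on
`M` two commuting Killing vector fields `X_a`, `a = 1, 2`, such that `(M, g)` is stationary with
respect to `X₁` and axisymmetric with respect to `X₂`"; the Lie algebra of `G₀` is the space of
complete Killing fields (ibid., proof of Thm. 1.2, "to any element `h` of `𝔏` there is associated
a unique Killing vector field `X(h)`, the orbit of which is complete"; O'Neill 1983, Ch. 9,
Prop. 9.33), the periodic element of a two-dimensional `𝔏 ∋ X₁, X₂` is `X₂ + α X₁` with `X₂`
NOT translational (ibid., proof, case ii): "all orbits of `X₂ + α X₁` are periodic with period `1`"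
after "replacing `X` by an appropriately chosen multiple"), and its axis is non-empty by Prop. 2.4
there.  (2) Its use for black holes, P. T. Chruściel, J. L. Costa, M. Heusler, Living Rev.
Relativity 15 (2012) 7 = arXiv:1205.6112, §3.2.1 (p. 10), in the setting "stationary,
asymptotically-flat, `I⁺`-regular, electrovacuum, four-dimensional" of their Thm. 3.2 and §3.3.1:
"Here one assumes from the outset that, in addition to the stationary Killing vector, there exists
a second Killing vector field. Assuming `I⁺`-regularity, one can invoke the positive energy theorem
to show [Beig–Chruściel 1997] that some linear combination of the Killing vectors, say `η`, must
have periodic orbits, and an axis of rotation, i.e., a two-dimensional totally-geodesic submanifold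
of `M` on which the Killing vector `η` vanishes" (the positive energy theorem supplies the timelike
ADM four-momentum of Thm. 1.1; the stationary vacuum end `M_ext ≅ ℝ × Σ_ext` has the full
asymptotics `g_{ij} - δ_{ij}, θ_i, V - 1 = O_∞(r^{-1})`, ibid. (2.10), and contains boost-type
domains of every slope).

What is vendored, hypothesis by hypothesis (every hypothesis implies the printed one, the
conclusion is implied by the printed one).  For every `𝓑 : StationaryAFBlackHole` — a connected
four-dimensional space-time with an asymptotically flat end and a complete Killing field
`T = 𝓑.killing` timelike on `M_ext` (**stationary, asymptotically flat, four-dimensional**) — which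
is `I⁺`-regular with connected (hence NON-EMPTY) non-degenerate event horizon
(`IsIPlusRegularNonDegenerate`: **`I⁺`-regular**, Chruściel–Costa 2008 Def. 1.1 = CCH12 Def. 2.1,
and a genuine black hole as in CCH12 §3 — this excludes Minkowski space-time, whose ADM
four-momentum vanishes, in accordance with "non-vanishing `p^μ`" of Thm. 1.1; the non-degeneracy
clause is EXTRA and only weakens the fact) and **vacuum** (`Ric = 0`, so `G_{μν} ≡ 0`;
⊆ electrovacuum), and for every **second Killing vector field** `K` on the whole carrier which is
COMPLETE (so that `T` and `K` lie in the Lie algebra of `G₀`), commutes with `T` (EXTRA) and is not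
a constant multiple of `T` (so `dim G₀ ≥ 2` and, `T` being timelike on the whole end, cases 3 and 5
of Thm. 1.2 remain; in case 3 the `U(1)`-generator lies in `𝔏 = span{T, K}`, in case 5
`[T, K] = 0` makes the `so(3)`-components of `T`, `K` proportional, so `span{T, K}` contains a
generator of a circle subgroup of `SO(3)` acting by rotations of the asymptotic spheres; in both
cases the periodic element is `a T + b K` with `b ≠ 0`, as `T` has no closed orbits through the
acausal hypersurface `S ⊇ Σ_ext` of Def. 1.1): some linear combination `a T + b K` with `b ≠ 0`
is complete, has ALL its integral curves `2π`-periodic (print: period `1`; the period is a choice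
of the multiple) and vanishes somewhere (non-empty axis).  Not vendored: that the axis is a
two-dimensional totally geodesic submanifold; the classification of `G₀`; the electrovacuum case.
[cite: BeigChrusciel1997, Thm. 1.2 (with Thm. 1.1, Props. 2.3–2.4)]
[cite: ChruscielCostaHeusler2012, §3.2.1 (p. 10)]
[file Geometry/Lorentzian/KillingAlgebraAsymptoticallyFlat] -/
def BeigChrusciel1997_axisymmetricCombination.{v} : Prop :=
  ∀ (𝓑 : StationaryAFBlackHole.{v}) [𝓑.metric.HasLeviCivita],
    𝓑.IsIPlusRegularNonDegenerate → 𝓑.metric.toPseudoRiemannianMetric.IsRicciFlat →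
    ∀ K : Π x : 𝓑.carrier, TangentSpace (modelWithCornersSelf ℝ (EuclideanSpace ℝ (Fin 4))) x,
      𝓑.metric.IsKillingField K → IsCompleteVectorField K →
      (∀ x, VectorField.mlieBracket (modelWithCornersSelf ℝ (EuclideanSpace ℝ (Fin 4)))
        𝓑.killing K x = 0) →
      (¬ ∃ c : ℝ, K = c • 𝓑.killing) →
      ∃ a b : ℝ, b ≠ 0 ∧
        IsCompleteVectorField (a • 𝓑.killing + b • K) ∧
        (∀ γ : ℝ → 𝓑.carrier, IsMIntegralCurve γ (a • 𝓑.killing + b • K) →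
          Function.Periodic γ (2 * Real.pi)) ∧
        ∃ x, (a • 𝓑.killing + b • K) x = 0

/-! ## Glue: linear combinations of the two Killing fields

Beig–Chruściel's periodic generator in case (ii) of the proof of Thm. 1.2 (arXiv p. 8: with `X₁`
translational and `X₂` rotational, `[X₁, X₂] = 0`, "we can choose `α` so that
`φ₁[X₂ + αX₁] = x + O(r^{-α})`. By point 3 of Theorem 1.1 we obtain `φ₁[X₂ + αX₁](p) = p`, hence
all orbits of `X₂ + αX₁` are periodic with period `1`") is a *linear combination* of the two
Killing fields, normalised afterwards ("Replacing `X^μ` by an appropriately chosen multiple thereof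
if necessary", Thm. 1.1; Prop. 2.3: `ω^i_j ω^j_i = 2(2π)²`). The elementary facts this rests on are
proved here in general: Killing fields form a real vector space (O'Neill 1983, Ch. 9, remark (1)
before Lemma 9.28: "any linear combination of Killing fields (coefficients constant) is again a
Killing field"); the integral curves of `c • V` are the reparametrised integral curves
`t ↦ γ(ct)` of `V` (Mathlib `IsMIntegralCurve.comp_mul`), so that completeness, periodicity of all
orbits and the zero set are insensitive to non-zero constant multiples, the period scaling by
`1/c`. Consequences recorded for the named fact: its **reduction to an arbitrary non-zero period**
(`BeigChrusciel1997_axisymmetricCombination.of_period`, the form in which Beig–Chruściel state it,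
period `1`) and its hypothesis-form corollary producing the stationary–axisymmetric presentation
used by Chruściel–Costa–Heusler 2012, §3.2.1 (`….exists_isAxisymmetricKilling`,
`….isStationaryAxisymmetric`). -/

section Glue

universe u

variable {E : Type*} [NormedAddCommGroup E] [NormedSpace ℝ E] {H : Type*} [TopologicalSpace H]
  {I : ModelWithCorners ℝ E H} {M : Type*} [TopologicalSpace M] [ChartedSpace H M] {n : ℕ∞ω}

/-! ### Killing fields form a real vector space -/

namespace PseudoRiemannianMetric

variable [IsManifold I ∞ M] [Fact (1 ≤ n)]
  {g : PseudoRiemannianMetric I n E (TangentSpace I : M → Type _)} [g.HasLeviCivita]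
  {X Y : Π x : M, TangentSpace I x}

/-- **Constant multiples of Killing fields are Killing fields**: `∇(c • X) = c • ∇X`
(`IsCovariantDerivativeOn.smul_const` at the `C^n` section `X`) and the Killing equation is
linear in `X`. O'Neill 1983, Ch. 9, Prop. 9.25 and remark (1) before Lemma 9.28.
[cite: ONeillSemiRiemannian1983, Ch. 9, remark (1) before Lemma 9.28] -/
theorem IsKillingField.const_smul (hX : g.IsKillingField X) (c : ℝ) :
    g.IsKillingField (c • X) := by
  refine ⟨hX.contMDiff.const_smul_section, fun x Y₀ Z₀ ↦ ?_⟩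
  have hXx : MDiffAt (T% X) x := (hX.contMDiff x).mdifferentiableAt (ENat.one_le_iff_ne_zero_withTop.mp Fact.out)
  have hs : g.leviCivita (c • X) x = c • g.leviCivita X x :=
    g.leviCivita.isCovariantDerivativeOnUniv.smul_const c hXx
  have h := hX.val_leviCivita_add x Y₀ Z₀
  simp only [hs, FunLike.coe_smul, Pi.smul_apply, map_smul, smul_eq_mul]
  linear_combination c * h

/-- **Sums of Killing fields are Killing fields**: `∇(X + Y) = ∇X + ∇Y`
(`IsCovariantDerivativeOn.add` at the `C^n` sections `X`, `Y`) and the Killing equation is linear.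
O'Neill 1983, Ch. 9, Prop. 9.25 and remark (1) before Lemma 9.28 ("any linear combination of
Killing fields (coefficients constant) is again a Killing field").
[cite: ONeillSemiRiemannian1983, Ch. 9, remark (1) before Lemma 9.28] -/
theorem IsKillingField.add (hX : g.IsKillingField X) (hY : g.IsKillingField Y) :
    g.IsKillingField (X + Y) := by
  refine ⟨hX.contMDiff.add_section hY.contMDiff, fun x Y₀ Z₀ ↦ ?_⟩
  have hXx : MDiffAt (T% X) x := (hX.contMDiff x).mdifferentiableAt (ENat.one_le_iff_ne_zero_withTop.mp Fact.out)
  have hYx : MDiffAt (T% Y) x := (hY.contMDiff x).mdifferentiableAt (ENat.one_le_iff_ne_zero_withTop.mp Fact.out)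
  have hs : g.leviCivita (X + Y) x = g.leviCivita X x + g.leviCivita Y x :=
    g.leviCivita.isCovariantDerivativeOnUniv.add hXx hYx
  have h₁ := hX.val_leviCivita_add x Y₀ Z₀
  have h₂ := hY.val_leviCivita_add x Y₀ Z₀
  simp only [hs, add_apply, map_add]
  linear_combination h₁ + h₂

/-- The negative of a Killing field is a Killing field. O'Neill 1983, Ch. 9, remark (1) before
Lemma 9.28. [cite: ONeillSemiRiemannian1983, Ch. 9, remark (1) before Lemma 9.28] -/
theorem IsKillingField.neg (hX : g.IsKillingField X) : g.IsKillingField (-X) := by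
  simpa using hX.const_smul (-1)

/-- Differences of Killing fields are Killing fields. O'Neill 1983, Ch. 9, remark (1) before
Lemma 9.28. [cite: ONeillSemiRiemannian1983, Ch. 9, remark (1) before Lemma 9.28] -/
theorem IsKillingField.sub (hX : g.IsKillingField X) (hY : g.IsKillingField Y) :
    g.IsKillingField (X - Y) := by
  simpa [sub_eq_add_neg] using hX.add hY.neg

/-- **Linear combinations `a • X + b • Y` of Killing fields are Killing fields** — the Killing
fields of `g` form a real vector space `𝔦(M)`. O'Neill 1983, Ch. 9, remark (1) before Lemma 9.28.
[cite: ONeillSemiRiemannian1983, Ch. 9, remark (1) before Lemma 9.28] -/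
theorem IsKillingField.linearCombination (hX : g.IsKillingField X) (hY : g.IsKillingField Y)
    (a b : ℝ) : g.IsKillingField (a • X + b • Y) :=
  (hX.const_smul a).add (hY.const_smul b)

end PseudoRiemannianMetric

/-! ### Constant multiples of complete vector fields: completeness, periods, zeros -/

section Rescale

variable {V : Π x : M, TangentSpace I x}

/-- **A constant multiple of a complete vector field is complete**: the integral curve of `c • V`
through `x` is `t ↦ γ(ct)` for the integral curve `γ` of `V` through `x`
(`IsMIntegralCurve.comp_mul`). Lee, *Introduction to Smooth Manifolds* (2012), Ch. 9,
Lemma 9.3 ("rescaling lemma") and the paragraph on complete fields (p. 215). [folklore] -/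
theorem IsCompleteVectorField.const_smul (hV : IsCompleteVectorField V) (c : ℝ) :
    IsCompleteVectorField (c • V) := fun x ↦ by
  obtain ⟨γ, hγ, h0⟩ := hV x
  exact ⟨γ ∘ (· * c), hγ.comp_mul c, by simp [h0]⟩

/-- Completeness is insensitive to non-zero constant multiples. [folklore] -/
theorem isCompleteVectorField_const_smul_iff {c : ℝ} (hc : c ≠ 0) :
    IsCompleteVectorField (c • V) ↔ IsCompleteVectorField V := by
  refine ⟨fun h ↦ ?_, fun h ↦ h.const_smul c⟩
  have h' := h.const_smul c⁻¹
  rwa [smul_smul, inv_mul_cancel₀ hc, one_smul] at h'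

/-- **Periods scale inversely with the field**: if every (whole-line) integral curve of `V` is
`p`-periodic, then every integral curve of `c • V`, `c ≠ 0`, is `(p / c)`-periodic (an integral
curve `γ` of `c • V` is `t ↦ δ(ct)` for the integral curve `δ = γ ∘ (· * c⁻¹)` of `V`). This is the
normalisation "replacing `X` by an appropriately chosen multiple" of Beig–Chruściel 1997, Thm. 1.1
and Prop. 2.3. [cite: BeigChrusciel1997, Thm. 1.1 (statement) and Prop. 2.3 (normalisation of ω)] -/
theorem periodic_of_isMIntegralCurve_const_smul {p c : ℝ} (hc : c ≠ 0)
    (hper : ∀ γ : ℝ → M, IsMIntegralCurve γ V → Function.Periodic γ p)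
    {γ : ℝ → M} (hγ : IsMIntegralCurve γ (c • V)) : Function.Periodic γ (p / c) := by
  have hγ' : IsMIntegralCurve (γ ∘ (· * c⁻¹)) V := by
    have h := hγ.comp_mul c⁻¹
    rwa [smul_smul, inv_mul_cancel₀ hc, one_smul] at h
  intro t
  have h := hper _ hγ' (t * c)
  simp only [Function.comp_apply, add_mul, mul_assoc, mul_inv_cancel₀ hc, mul_one] at h
  simpa [div_eq_mul_inv] using h

/-- **Normalisation to period `2π`**: if every integral curve of `V` is `p`-periodic, `p ≠ 0`,
then every integral curve of `(p / 2π) • V` is `2π`-periodic (the convention of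
`Spacetime.IsAxisymmetricKilling`; Beig–Chruściel normalise to period `1`).
[cite: BeigChrusciel1997, Thm. 1.1 (statement) and Prop. 2.3] -/
theorem periodic_two_pi_of_isMIntegralCurve_smul {p : ℝ} (hp : p ≠ 0)
    (hper : ∀ γ : ℝ → M, IsMIntegralCurve γ V → Function.Periodic γ p)
    {γ : ℝ → M} (hγ : IsMIntegralCurve γ ((p / (2 * Real.pi)) • V)) :
    Function.Periodic γ (2 * Real.pi) := by
  have hc : p / (2 * Real.pi) ≠ 0 := div_ne_zero hp (by positivity)
  have h := periodic_of_isMIntegralCurve_const_smul hc hper hγ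
  have hpc : p / (p / (2 * Real.pi)) = 2 * Real.pi := by
    field_simp
  rwa [hpc] at h

/-- The zero set (axis) of a non-zero constant multiple of `V` is that of `V`. [folklore] -/
theorem const_smul_apply_eq_zero_iff {c : ℝ} (hc : c ≠ 0) (x : M) :
    (c • V) x = 0 ↔ V x = 0 := by
  simp [hc]

end Rescale

/-! ### The named fact: reduction to any non-zero period, and its use -/

/-- **Reduction of the Beig–Chruściel combination to an arbitrary non-zero period.** To establish
`BeigChrusciel1997_axisymmetricCombination` it suffices to produce, for every `𝓑`, `K` as there,
a combination `a • T + b • K` with `b ≠ 0` which is complete, all of whose integral curves are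
`p`-periodic for *some* `p ≠ 0`, and which vanishes somewhere: the multiple
`(p / 2π) • (a • T + b • K) = (pa/2π) • T + (pb/2π) • K` is then complete
(`IsCompleteVectorField.const_smul`), has `2π`-periodic integral curves
(`periodic_two_pi_of_isMIntegralCurve_smul`) and the same zeros. This is exactly the form in which
Beig–Chruściel obtain the periodic element — "all orbits of `X₂ + αX₁` are periodic with period `1`"
(proof of Thm. 1.2, case (ii)), after the normalisation of Thm. 1.1 / Prop. 2.3.
[cite: BeigChrusciel1997, proof of Thm. 1.2, case (ii) (arXiv p. 8) and Thm. 1.1] -/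
theorem BeigChrusciel1997_axisymmetricCombination.of_period.{v}
    (h : ∀ (𝓑 : StationaryAFBlackHole.{v}) [𝓑.metric.HasLeviCivita],
      𝓑.IsIPlusRegularNonDegenerate → 𝓑.metric.toPseudoRiemannianMetric.IsRicciFlat →
      ∀ K : Π x : 𝓑.carrier, TangentSpace (𝓡 4) x,
        𝓑.metric.IsKillingField K → IsCompleteVectorField K →
        (∀ x, VectorField.mlieBracket (𝓡 4) 𝓑.killing K x = 0) →
        (¬ ∃ c : ℝ, K = c • 𝓑.killing) →
        ∃ a b p : ℝ, b ≠ 0 ∧ p ≠ 0 ∧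
          IsCompleteVectorField (a • 𝓑.killing + b • K) ∧
          (∀ γ : ℝ → 𝓑.carrier, IsMIntegralCurve γ (a • 𝓑.killing + b • K) →
            Function.Periodic γ p) ∧
          ∃ x, (a • 𝓑.killing + b • K) x = 0) :
    BeigChrusciel1997_axisymmetricCombination.{v} := by
  intro 𝓑 _ hreg hvac K hK hKc hcomm hrot
  obtain ⟨a, b, p, hb, hp, hc, hper, x, hx⟩ := h 𝓑 hreg hvac K hK hKc hcomm hrot
  have hc0 : p / (2 * Real.pi) ≠ 0 := div_ne_zero hp (by positivity)
  have key : (p / (2 * Real.pi)) • (a • 𝓑.killing + b • K) =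
      (p / (2 * Real.pi) * a) • 𝓑.killing + (p / (2 * Real.pi) * b) • K := by
    rw [smul_add, smul_smul, smul_smul]
  refine ⟨p / (2 * Real.pi) * a, p / (2 * Real.pi) * b, mul_ne_zero hc0 hb, ?_, ?_, x, ?_⟩
  · rw [← key]
    exact hc.const_smul _
  · intro γ hγ
    rw [← key] at hγ
    exact periodic_two_pi_of_isMIntegralCurve_smul hp hper hγ
  · rw [← key, Pi.smul_apply, hx, smul_zero]

namespace StationaryAFBlackHole

variable (𝓑 : StationaryAFBlackHole.{u}) [𝓑.metric.HasLeviCivita]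

/-- **`[T, a • T + b • K] = 0` when `[T, K] = 0`**: bilinearity and skew-symmetry of the Lie
bracket of vector fields (Mathlib `VectorField.mlieBracket_add_right`,
`mlieBracket_const_smul_right`, `mlieBracket_self`, at the `C^∞` sections `T = 𝓑.killing`, `K`).
O'Neill 1983, Ch. 1, Lemma 1.18. [cite: ONeillSemiRiemannian1983, Ch. 1, Lemma 1.18] -/
theorem mlieBracket_killing_linearCombination {K : Π x : 𝓑.carrier, TangentSpace (𝓡 4) x}
    (hK : 𝓑.metric.IsKillingField K)
    (hcomm : ∀ x, VectorField.mlieBracket (𝓡 4) 𝓑.killing K x = 0) (a b : ℝ)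
    (x : 𝓑.carrier) :
    VectorField.mlieBracket (𝓡 4) 𝓑.killing (a • 𝓑.killing + b • K) x = 0 := by
  have hT : 𝓑.metric.IsKillingField 𝓑.killing := 𝓑.isStationaryKilling.isKillingField
  have hTx : MDifferentiableAt (𝓡 4) (𝓡 4).tangent
      (fun y ↦ (⟨y, 𝓑.killing y⟩ : TangentBundle (𝓡 4) 𝓑.carrier)) x :=
    (hT.contMDiff x).mdifferentiableAt (by simp)
  have hKx : MDifferentiableAt (𝓡 4) (𝓡 4).tangent
      (fun y ↦ (⟨y, K y⟩ : TangentBundle (𝓡 4) 𝓑.carrier)) x :=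
    (hK.contMDiff x).mdifferentiableAt (by simp)
  rw [VectorField.mlieBracket_add_right hTx.smul_const_section hKx.smul_const_section,
    VectorField.mlieBracket_const_smul_right hTx, VectorField.mlieBracket_const_smul_right hKx,
    VectorField.mlieBracket_self, hcomm x]
  simp

omit [𝓑.metric.HasLeviCivita] in
/-- **`a • T + b • K ≢ 0` when `b ≠ 0` and `K ∉ ℝT`**: if `a • T + b • K` vanished identically
then `K = (-(a / b)) • T`. (Linear algebra.) [folklore] -/
theorem exists_linearCombination_apply_ne_zero {K : Π x : 𝓑.carrier, TangentSpace (𝓡 4) x}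
    (hrot : ¬ ∃ c : ℝ, K = c • 𝓑.killing) {a b : ℝ} (hb : b ≠ 0) :
    ∃ x, (a • 𝓑.killing + b • K) x ≠ 0 := by
  by_contra h
  push Not at h
  refine hrot ⟨-(a / b), funext fun x ↦ ?_⟩
  have hx : b • K x = -(a • 𝓑.killing x) := by
    rw [eq_neg_iff_add_eq_zero, add_comm]
    simpa using h x
  calc K x = b⁻¹ • (b • K x) := by rw [smul_smul, inv_mul_cancel₀ hb, one_smul]
    _ = (-(a / b)) • 𝓑.killing x := by
      rw [hx, smul_neg, smul_smul, ← neg_smul]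
      congr 1
      ring

/-- **A complete linear combination `a • T + b • K` (`b ≠ 0`, `K ∉ ℝT`) with `2π`-periodic orbits
and non-empty axis is an axisymmetric Killing field commuting with `T`** — the conclusion of
`BeigChrusciel1997_axisymmetricCombination` repackaged as `Spacetime.IsAxisymmetricKilling`
(Heusler 1996, Def. 2.6) plus `[T, ·] = 0`: Killing by `IsKillingField.linearCombination`,
non-trivial by `exists_linearCombination_apply_ne_zero`, commuting by
`mlieBracket_killing_linearCombination`. Chruściel–Costa–Heusler 2012, §3.2.1 (p. 10).
[cite: ChruscielCostaHeusler2012, §3.2.1 (p. 10)] -/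
theorem isAxisymmetricKilling_linearCombination {K : Π x : 𝓑.carrier, TangentSpace (𝓡 4) x}
    (hK : 𝓑.metric.IsKillingField K)
    (hcomm : ∀ x, VectorField.mlieBracket (𝓡 4) 𝓑.killing K x = 0)
    (hrot : ¬ ∃ c : ℝ, K = c • 𝓑.killing) {a b : ℝ} (hb : b ≠ 0)
    (hc : IsCompleteVectorField (a • 𝓑.killing + b • K))
    (hper : ∀ γ : ℝ → 𝓑.carrier, IsMIntegralCurve γ (a • 𝓑.killing + b • K) →
      Function.Periodic γ (2 * Real.pi))
    (haxis : ∃ x, (a • 𝓑.killing + b • K) x = 0) :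
    𝓑.toSpacetime.IsAxisymmetricKilling (a • 𝓑.killing + b • K) ∧
      ∀ x, VectorField.mlieBracket (𝓡 4) 𝓑.killing (a • 𝓑.killing + b • K) x = 0 :=
  ⟨⟨𝓑.isStationaryKilling.isKillingField.linearCombination hK a b, hc, hper,
      𝓑.exists_linearCombination_apply_ne_zero hrot hb, haxis⟩,
    𝓑.mlieBracket_killing_linearCombination hK hcomm a b⟩

end StationaryAFBlackHole

/-- **Hypothesis form of the Beig–Chruściel combination, packaged**: given the named fact, an
`I⁺`-regular vacuum stationary AF black hole with connected non-degenerate horizon and a complete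
second Killing field `K` commuting with `T` and not in `ℝT` carries an axisymmetric Killing field
`a • T + b • K` (`b ≠ 0`) commuting with `T`. Chruściel–Costa–Heusler 2012, §3.2.1: "some linear
combination of the Killing vectors, say `η`, must have periodic orbits, and an axis of rotation".
[cite: ChruscielCostaHeusler2012, §3.2.1 (p. 10)] [cite: BeigChrusciel1997, Thm. 1.2] -/
theorem BeigChrusciel1997_axisymmetricCombination.exists_isAxisymmetricKilling.{v}
    (h : BeigChrusciel1997_axisymmetricCombination.{v}) (𝓑 : StationaryAFBlackHole.{v})
    [𝓑.metric.HasLeviCivita] (hreg : 𝓑.IsIPlusRegularNonDegenerate)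
    (hvac : 𝓑.metric.toPseudoRiemannianMetric.IsRicciFlat)
    {K : Π x : 𝓑.carrier, TangentSpace (𝓡 4) x} (hK : 𝓑.metric.IsKillingField K)
    (hKc : IsCompleteVectorField K)
    (hcomm : ∀ x, VectorField.mlieBracket (𝓡 4) 𝓑.killing K x = 0)
    (hrot : ¬ ∃ c : ℝ, K = c • 𝓑.killing) :
    ∃ a b : ℝ, b ≠ 0 ∧ 𝓑.toSpacetime.IsAxisymmetricKilling (a • 𝓑.killing + b • K) ∧
      ∀ x, VectorField.mlieBracket (𝓡 4) 𝓑.killing (a • 𝓑.killing + b • K) x = 0 := by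
  obtain ⟨a, b, hb, hc, hper, haxis⟩ := h 𝓑 hreg hvac K hK hKc hcomm hrot
  exact ⟨a, b, hb, 𝓑.isAxisymmetricKilling_linearCombination hK hcomm hrot hb hc hper haxis⟩

/-- **The Beig–Chruściel combination makes the presentation stationary–axisymmetric**: given the
named fact, under its hypotheses `𝓑.IsStationaryAxisymmetric` holds (the hypothesis of
Chruściel–Costa–Heusler's Thm. 3.2, `ChruscielCostaHeusler2012_axisymmetricUniqueness`).
Chruściel–Costa–Heusler 2012, §3.2.1 (p. 10). [cite: ChruscielCostaHeusler2012, §3.2.1 (p. 10)] -/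
theorem BeigChrusciel1997_axisymmetricCombination.isStationaryAxisymmetric.{v}
    (h : BeigChrusciel1997_axisymmetricCombination.{v}) (𝓑 : StationaryAFBlackHole.{v})
    [𝓑.metric.HasLeviCivita] (hreg : 𝓑.IsIPlusRegularNonDegenerate)
    (hvac : 𝓑.metric.toPseudoRiemannianMetric.IsRicciFlat)
    {K : Π x : 𝓑.carrier, TangentSpace (𝓡 4) x} (hK : 𝓑.metric.IsKillingField K)
    (hKc : IsCompleteVectorField K)
    (hcomm : ∀ x, VectorField.mlieBracket (𝓡 4) 𝓑.killing K x = 0)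
    (hrot : ¬ ∃ c : ℝ, K = c • 𝓑.killing) : 𝓑.IsStationaryAxisymmetric := by
  obtain ⟨a, b, -, hY, hTY⟩ := h.exists_isAxisymmetricKilling 𝓑 hreg hvac hK hKc hcomm hrot
  exact fun {_} ↦ ⟨a • 𝓑.killing + b • K, hY, hTY⟩

end Glue

end Literature.Geometry.Lorentzian
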